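import Literature.Geometry.Symplectic.ZeroCircleBlockChart
import Literature.Geometry.Symplectic.BlockReparam
import Literature.Geometry.Manifold.PeriodicTubeInjectivity
import HarnessLib

/-!
# An adapted tubular chart about an even zero circle: block form of the `1`-jet

Topic `Geometry/Symplectic`; namespace `Literature.Geometry.Symplectic`.  Theorems only; no named
fact, no `sorry`.  Precomposing the chart `χ` of `IsEvenZeroCircle.exists_blockChart` with the
block reparametrisation `Φ(q) = A(q₀) q` (`BlockReparam`) gives a chart `χ₂ = χ ∘ Φ` about the
even zero circle `γ` of a strictly near-symplectic form `sf` with the same qualitative properties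
(`2π`-periodic, `C^∞`, immersive and injective modulo `2πℤ e₀` on a model tube, image in the
prescribed open set, `χ₂(θ e₀) = γ(θ)`, zeros of `sf` on the tube exactly on the axis) and whose
`1`-jet at the axis is in BLOCK FORM in standard coordinates:
`∇(χ₂^* sf)_{θ e₀}(W)(U, V) = σ Σ_k (M(θ) x(W))_k β_k(U, V)`, `M = M⁺ ⊕ (m₃₃)`, `M⁺ > 0`,
`m₃₃ < 0`, `σ = ±1` (`IsEvenZeroCircle.exists_adaptedChart`).  This completes step 1 of the
proof of Perutz's Lemma 3.1 (for an even circle), metric-free.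

## References

* T. Perutz, *Zero-sets of near-symplectic forms*, J. Symplectic Geom. 4 (2006), §3, Lemma 3.1.
  [Perutz2006]
* K. Honda, *Local properties of self-dual harmonic 2-forms on a 4-manifold*, J. reine angew.
  Math. 577 (2004), Thm. 5. [Honda2004LocalSD]
-/

noncomputable section

open scoped Manifold ContDiff Topology Real Matrix
open Set Function Bundle Filter Module Matrix Real Literature.Topology.FourManifolds
  Literature.Geometry.Kaehler Literature.Geometry.Manifold

namespace Literature.Geometry.Symplectic

universe u

/-! ### The embedding `ℝ × ℝ³ → ℝ⁴` -/

/-- `(θ, x) ↦ θ e₀ + Σ xₖ e_{k+1}`. [folklore] -/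
theorem tubeEmb_apply_zero (p : ℝ × (Fin 3 → ℝ)) : (hondaAxisPoint p.1 + normalLift p.2) 0 = p.1 := by
  simp [normalLift_apply_zero]

/-- Normal coordinates of `θ e₀ + Σ xₖ e_{k+1}`. [folklore] -/
theorem tubeEmb_apply_succ (p : ℝ × (Fin 3 → ℝ)) (k : Fin 3) :
    (hondaAxisPoint p.1 + normalLift p.2) k.succ = p.2 k := by
  simp [normalLift_apply_succ]

/-- Every point splits as `q = q₀ e₀ + Σ q_{k+1} e_{k+1}`. [folklore] -/
theorem hondaAxisPoint_add_normalLift (q : EuclideanSpace ℝ (Fin 4)) :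
    hondaAxisPoint (q 0) + normalLift (normalPart q) = q := by
  ext i
  induction i using Fin.cases with
  | zero => simp [normalLift_apply_zero]
  | succ k => simp [normalLift_apply_succ, normalPart_apply]

/-- The embedding is injective. [folklore] -/
theorem tubeEmb_injective : Injective fun p : ℝ × (Fin 3 → ℝ) ↦ hondaAxisPoint p.1 + normalLift p.2 := by
  intro p p' h
  have h0 := congrArg (fun q : EuclideanSpace ℝ (Fin 4) ↦ q 0) h
  simp only [tubeEmb_apply_zero] at h0
  have hk : ∀ k : Fin 3, p.2 k = p'.2 k := fun k ↦ by
    have := congrArg (fun q : EuclideanSpace ℝ (Fin 4) ↦ q k.succ) h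
    simpa only [tubeEmb_apply_succ] using this
  exact Prod.ext h0 (funext hk)

/-- The embedding is continuous. [folklore] -/
theorem continuous_tubeEmb : Continuous fun p : ℝ × (Fin 3 → ℝ) ↦ hondaAxisPoint p.1 + normalLift p.2 := by
  refine (contDiff_hondaAxisPoint.continuous.comp continuous_fst).add ?_
  unfold normalLift
  exact continuous_finsetSum _ fun k _ ↦
    ((continuous_apply k).comp continuous_snd).smul continuous_const

/-- On a tube the normal part has small sup-norm. [folklore] -/
theorem norm_normalPart_lt_of_mem_hondaTube {r : ℝ} (hr : 0 < r) {q : EuclideanSpace ℝ (Fin 4)}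
    (hq : q ∈ hondaTube r) : ‖normalPart q‖ < r :=
  norm_tail_lt_of_mem_hondaTube hr hq

/-! ### Local injectivity of a chart which is injective modulo the period -/

variable {M : Type u} [TopologicalSpace M] [ChartedSpace (EuclideanSpace ℝ (Fin 4)) M]

omit [TopologicalSpace M] [ChartedSpace (EuclideanSpace ℝ (Fin 4)) M] in
/-- A chart injective modulo `2πℤ e₀` on a tube is injective on the part of the tube where the
axis coordinate stays within `π` of a fixed value. [folklore] -/
theorem injOn_of_eq_add_of_eq {χ : EuclideanSpace ℝ (Fin 4) → M} {r : ℝ}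
    (hχinj : ∀ q ∈ hondaTube r, ∀ q' ∈ hondaTube r, χ q' = χ q →
      ∃ k : ℤ, q' = q + (2 * π * k) • EuclideanSpace.single 0 1) (θ : ℝ) :
    InjOn χ (hondaTube r ∩ {q | |q 0 - θ| < π}) := by
  rintro q ⟨hq, hqθ⟩ q' ⟨hq', hq'θ⟩ h
  obtain ⟨k, hk⟩ := hχinj q hq q' hq' h.symm
  have h0 : q' 0 = q 0 + 2 * π * k := by rw [hk]; simp
  simp only [mem_setOf_eq] at hqθ hq'θ
  have hk1 : |(k : ℝ)| < 1 := by
    have h1 : |q' 0 - q 0| < 2 * π := by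
      calc |q' 0 - q 0| = |(q' 0 - θ) - (q 0 - θ)| := by ring_nf
        _ ≤ |q' 0 - θ| + |q 0 - θ| := abs_sub _ _
        _ < π + π := add_lt_add hq'θ hqθ
        _ = 2 * π := by ring
    rw [h0, add_sub_cancel_left, abs_mul, abs_of_pos two_pi_pos] at h1
    nlinarith [pi_pos]
  have hk0 : k = 0 := by
    have : |k| < 1 := by exact_mod_cast hk1
    exact Int.abs_lt_one_iff.1 this
  rw [hk, hk0]; simp

/-! ### The adapted chart -/

variable [IsManifold (𝓡 4) ∞ M] [T2Space M] [SigmaCompactSpace M]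

set_option maxHeartbeats 800000 in
/-- **Adapted tubular chart about an even zero circle** (Perutz 2006, proof of Lemma 3.1,
step 1; Honda 2004, proof of Thm. 5): for a strictly near-symplectic `sf`, an even zero circle
`γ` and an open `N ⊇ γ(ℝ)`, a `2π`-periodic chart `χ : ℝ⁴ → M`, `C^∞`, immersive and injective
modulo `2πℤ e₀` on `hondaTube r`, `χ(hondaTube r) ⊆ N`, `χ(θ e₀) = γ(θ)`, zeros of `sf` on the
tube exactly on the axis, and with `1`-jet of `χ^* sf` at the axis in block form
`∇(χ^*sf)_{θe₀}(W)(U, V) = σ Σ_k (M(θ) x(W))_k β_k(U, V)`, `M` smooth periodic symmetric,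
`M = M⁺ ⊕ (m₃₃)` with `M⁺ > 0 > m₃₃`, `σ = ±1`. [cite: Perutz2006, Lemma 3.1 (proof, step 1)] -/
theorem IsEvenZeroCircle.exists_adaptedChart (o : SmoothOrientation (𝓡 4) M)
    {sf : MForm (𝓡 4) M ℝ 2} {γ : ℝ → M} (hsf : IsStrictlyNearSymplectic o sf)
    (h : IsEvenZeroCircle sf γ) {N : Set M} (hN : IsOpen N) (hγN : range γ ⊆ N) :
    ∃ (r : ℝ) (χ : EuclideanSpace ℝ (Fin 4) → M) (σ : ℝ) (Mb : ℝ → Matrix (Fin 3) (Fin 3) ℝ),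
      0 < r ∧
      (∀ q, χ (q + (2 * π) • EuclideanSpace.single 0 1) = χ q) ∧
      ContMDiffOn 𝓘(ℝ, EuclideanSpace ℝ (Fin 4)) (𝓡 4) ∞ χ (hondaTube r) ∧
      (∀ q ∈ hondaTube r, ∀ q' ∈ hondaTube r, χ q' = χ q →
        ∃ k : ℤ, q' = q + (2 * π * k) • EuclideanSpace.single 0 1) ∧
      (∀ q ∈ hondaTube r, Injective (mfderiv 𝓘(ℝ, EuclideanSpace ℝ (Fin 4)) (𝓡 4) χ q)) ∧
      χ '' hondaTube r ⊆ N ∧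
      (∀ q ∈ hondaAxis, χ q = γ (q 0)) ∧
      χ '' hondaAxis = range γ ∧
      zeroLocus sf ∩ χ '' hondaTube r = χ '' hondaAxis ∧
      (∀ i j, ContDiff ℝ ∞ fun θ ↦ Mb θ i j) ∧ (σ = 1 ∨ σ = -1) ∧ (∀ θ, (Mb θ).IsSymm) ∧
      (∀ θ (m : Fin 3), Mb θ m 2 = if m = 2 then Mb θ 2 2 else 0) ∧ (∀ θ, Mb θ 2 2 < 0) ∧
      (∀ θ (v : Fin 3 → ℝ), v 2 = 0 → v ≠ 0 → 0 < v ⬝ᵥ Mb θ *ᵥ v) ∧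
      (∀ θ, Mb (θ + 2 * π) = Mb θ) ∧
      ∀ θ W U V, zeroGradient (sf.pullback 𝓘(ℝ, EuclideanSpace ℝ (Fin 4)) χ) (hondaAxisPoint θ)
          W ![U, V] = σ * ∑ k, (Mb θ *ᵥ normalPart W) k * hondaBetaVec U V k := by
  obtain ⟨r, χ, A, σ, Mb, hr, hχper, hχs, hχinj, hχimm, hχN, hχγ, hχax, hzero, hAs, hMs, hσ, hA0,
    hMsym, hblock, hneg, hposb, hgrad, hAP, hMP⟩ := h.exists_blockChart o hsf hN hγN
  -- the reparametrisation and its thin tube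
  set Φ := blockReparam A with hΦ
  obtain ⟨r₂, hr₂, hmaps, hdinj⟩ := exists_radius_blockReparam hAs hA0 two_pi_pos hAP hr
  have hΦs : ContDiff ℝ ∞ Φ := contDiff_blockReparam hAs
  have hΦd : ∀ q, DifferentiableAt ℝ Φ q := fun q ↦ hΦs.differentiable (by simp) q
  have hΦmd : ∀ q, MDifferentiableAt 𝓘(ℝ, EuclideanSpace ℝ (Fin 4)) 𝓘(ℝ, EuclideanSpace ℝ (Fin 4))
      Φ q := fun q ↦ mdifferentiableAt_iff_differentiableAt.2 (hΦd q)
  have hχmd : ∀ p ∈ hondaTube r, MDifferentiableAt 𝓘(ℝ, EuclideanSpace ℝ (Fin 4)) (𝓡 4) χ p :=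
    fun p hp ↦ ((hχs p hp).contMDiffAt ((isOpen_hondaTube r).mem_nhds hp)).mdifferentiableAt
      (by simp)
  have hΦax : ∀ θ, Φ (hondaAxisPoint θ) = hondaAxisPoint θ := blockReparam_hondaAxisPoint hA0
  have hΦper : ∀ q, Φ (q + (2 * π) • EuclideanSpace.single 0 1) =
      Φ q + (2 * π) • EuclideanSpace.single 0 1 := blockReparam_add_smul hA0 hAP
  set χ₂ : EuclideanSpace ℝ (Fin 4) → M := χ ∘ Φ with hχ₂
  -- qualitative properties of `χ₂`
  have h2per : ∀ q, χ₂ (q + (2 * π) • EuclideanSpace.single 0 1) = χ₂ q := fun q ↦ by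
    simp only [hχ₂, Function.comp_apply, hΦper, hχper]
  have h2s : ContMDiffOn 𝓘(ℝ, EuclideanSpace ℝ (Fin 4)) (𝓡 4) ∞ χ₂ (hondaTube r₂) :=
    hχs.comp hΦs.contMDiff.contMDiffOn hmaps
  have h2d : ∀ q ∈ hondaTube r₂, mfderiv 𝓘(ℝ, EuclideanSpace ℝ (Fin 4)) (𝓡 4) χ₂ q =
      (mfderiv 𝓘(ℝ, EuclideanSpace ℝ (Fin 4)) (𝓡 4) χ (Φ q)).comp (fderiv ℝ Φ q) := by
    intro q hq
    rw [hχ₂, mfderiv_comp q (hχmd _ (hmaps hq)) (hΦmd q), mfderiv_eq_fderiv]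
    rfl
  have h2imm : ∀ q ∈ hondaTube r₂,
      Injective (mfderiv 𝓘(ℝ, EuclideanSpace ℝ (Fin 4)) (𝓡 4) χ₂ q) := fun q hq ↦ by
    rw [h2d q hq]
    exact (hχimm _ (hmaps hq)).comp (hdinj q hq)
  have h2γ : ∀ q ∈ hondaAxis, χ₂ q = γ (q 0) := fun q hq ↦ by
    rw [hχ₂, Function.comp_apply, eq_hondaAxisPoint_of_mem_hondaAxis hq, hΦax, hχγ _
      (hondaAxisPoint_mem_hondaAxis _), hondaAxisPoint_apply_zero]
  have h2ax : χ₂ '' hondaAxis = range γ := by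
    rw [← hχax]
    refine Set.Subset.antisymm ?_ ?_
    · rintro _ ⟨q, hq, rfl⟩
      refine ⟨q, hq, ?_⟩
      rw [hχ₂, Function.comp_apply, eq_hondaAxisPoint_of_mem_hondaAxis hq, hΦax]
    · rintro _ ⟨q, hq, rfl⟩
      refine ⟨q, hq, ?_⟩
      rw [hχ₂, Function.comp_apply, eq_hondaAxisPoint_of_mem_hondaAxis hq, hΦax]
  -- injectivity modulo the period on a thinner tube (periodic tube injectivity)
  set g : ℝ × (Fin 3 → ℝ) → M := fun p ↦ χ₂ (hondaAxisPoint p.1 + normalLift p.2) with hg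
  have hgper : ∀ θ x, g (θ + 2 * π, x) = g (θ, x) := fun θ x ↦ by
    simp only [hg, hondaAxisPoint_add]
    rw [add_right_comm, h2per]
  have hg0 : ∀ θ, g (θ, 0) = γ θ := fun θ ↦ by
    simp only [hg]
    rw [show normalLift (0 : Fin 3 → ℝ) = 0 by simp [normalLift], add_zero, hχ₂,
      Function.comp_apply, hΦax, hχγ _ (hondaAxisPoint_mem_hondaAxis _),
      hondaAxisPoint_apply_zero]
  have hgcont : ∀ θ : ℝ, ContinuousAt g (θ, 0) := by
    intro θ
    have hmem : hondaAxisPoint θ ∈ hondaTube r₂ := hondaAxisPoint_mem_hondaTube hr₂ θ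
    have hc : ContinuousAt χ₂ (hondaAxisPoint θ) :=
      (h2s.continuousOn.continuousWithinAt hmem).continuousAt
        ((isOpen_hondaTube r₂).mem_nhds hmem)
    have he : ContinuousAt (fun p : ℝ × (Fin 3 → ℝ) ↦ hondaAxisPoint p.1 + normalLift p.2) (θ, 0) :=
      continuous_tubeEmb.continuousAt
    have heq : hondaAxisPoint ((θ, (0 : Fin 3 → ℝ)).1) + normalLift ((θ, (0 : Fin 3 → ℝ)).2) =
        hondaAxisPoint θ := by simp [normalLift]
    rw [← heq] at hc
    exact ContinuousAt.comp (f := fun p : ℝ × (Fin 3 → ℝ) ↦ hondaAxisPoint p.1 + normalLift p.2)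
      (x := (θ, 0)) hc he
  have hginj : ∀ θ θ' : ℝ, g (θ, 0) = g (θ', 0) → ∃ k : ℤ, θ' = θ + k * (2 * π) := by
    intro θ θ' hθ
    rw [hg0, hg0] at hθ
    obtain ⟨k, hk⟩ := h.isZeroCircle.eq_add_of_eq θ θ' hθ.symm
    exact ⟨k, by rw [hk]; ring⟩
  have hgloc : ∀ θ : ℝ, ∃ U ∈ 𝓝 ((θ, 0) : ℝ × (Fin 3 → ℝ)), InjOn g U := by
    intro θ
    obtain ⟨U₁, hU₁, hinj₁⟩ := exists_nhds_injOn_blockReparam hAs hA0 θ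
    set W : Set (EuclideanSpace ℝ (Fin 4)) := hondaTube r ∩ {q | |q 0 - θ| < π} with hW
    have hWo : IsOpen W := (isOpen_hondaTube r).inter
      (isOpen_lt (continuous_abs.comp (((EuclideanSpace.proj (0 : Fin 4)).continuous).sub
        continuous_const)) continuous_const)
    have hWmem : Φ (hondaAxisPoint θ) ∈ W := by
      rw [hΦax]
      exact ⟨hondaAxisPoint_mem_hondaTube hr θ, by simp [pi_pos]⟩
    have hU₂ : Φ ⁻¹' W ∈ 𝓝 (hondaAxisPoint θ) :=
      hΦs.continuous.continuousAt.preimage_mem_nhds (hWo.mem_nhds hWmem)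
    have hinj₂ : InjOn χ₂ (U₁ ∩ Φ ⁻¹' W) := by
      rintro q ⟨hq₁, hq₂⟩ q' ⟨hq'₁, hq'₂⟩ hqq
      exact hinj₁ hq₁ hq'₁ (injOn_of_eq_add_of_eq hχinj θ hq₂ hq'₂ hqq)
    refine ⟨(fun p : ℝ × (Fin 3 → ℝ) ↦ hondaAxisPoint p.1 + normalLift p.2) ⁻¹' (U₁ ∩ Φ ⁻¹' W),
      ?_, ?_⟩
    · refine continuous_tubeEmb.continuousAt.preimage_mem_nhds ?_
      have heq : hondaAxisPoint ((θ, (0 : Fin 3 → ℝ)).1) + normalLift ((θ, (0 : Fin 3 → ℝ)).2) =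
          hondaAxisPoint θ := by simp [normalLift]
      rw [heq]; exact inter_mem hU₁ hU₂
    · intro p hp p' hp' hpp
      exact tubeEmb_injective (hinj₂ hp hp' hpp)
  obtain ⟨ρ, hρ, hinjρ⟩ := exists_radius_injOn_mod_period two_pi_pos hgper hgcont hginj hgloc
  -- the final radius
  set r₃ : ℝ := min r₂ ρ with hr₃
  have hr₃pos : 0 < r₃ := lt_min hr₂ hρ
  have h32 : hondaTube r₃ ⊆ hondaTube r₂ := hondaTube_mono hr₃pos.le (min_le_left _ _)
  have h2inj : ∀ q ∈ hondaTube r₃, ∀ q' ∈ hondaTube r₃, χ₂ q' = χ₂ q →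
      ∃ k : ℤ, q' = q + (2 * π * k) • EuclideanSpace.single 0 1 := by
    intro q hq q' hq' hqq
    have hx : ‖normalPart q‖ < ρ :=
      lt_of_lt_of_le (norm_normalPart_lt_of_mem_hondaTube hr₃pos hq) (min_le_right _ _)
    have hx' : ‖normalPart q'‖ < ρ :=
      lt_of_lt_of_le (norm_normalPart_lt_of_mem_hondaTube hr₃pos hq') (min_le_right _ _)
    have hgq : g (q 0, normalPart q) = χ₂ q := by
      simp only [hg, hondaAxisPoint_add_normalLift]
    have hgq' : g (q' 0, normalPart q') = χ₂ q' := by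
      simp only [hg, hondaAxisPoint_add_normalLift]
    obtain ⟨hxx, k, hk⟩ := hinjρ (q 0) (q' 0) (normalPart q) (normalPart q') hx hx'
      (by rw [hgq, hgq', hqq])
    refine ⟨k, ?_⟩
    rw [← hondaAxisPoint_add_normalLift q', ← hondaAxisPoint_add_normalLift q, hk, ← hxx,
      show (q 0 + k * (2 * π)) = q 0 + 2 * π * k by ring, hondaAxisPoint_add]
    abel
  -- zeros on the tube are on the axis
  have h2zero : zeroLocus sf ∩ χ₂ '' hondaTube r₃ = χ₂ '' hondaAxis := by
    refine Set.Subset.antisymm ?_ ?_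
    · rintro x ⟨hx, q, hq, rfl⟩
      have hΦq : Φ q ∈ hondaTube r := hmaps (h32 hq)
      have hmem : χ (Φ q) ∈ zeroLocus sf ∩ χ '' hondaTube r := ⟨hx, Φ q, hΦq, rfl⟩
      rw [hzero] at hmem
      obtain ⟨a, ha, hax⟩ := hmem
      obtain ⟨k, hk⟩ := hχinj a (hondaAxis_subset_hondaTube hr ha) (Φ q) hΦq hax.symm
      have hΦqax : Φ q ∈ hondaAxis := by
        rw [hk]; rw [mem_hondaAxis] at ha ⊢; simpa using ha
      exact ⟨q, mem_hondaAxis_of_blockReparam_mem hA0 hΦqax, rfl⟩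
    · rintro x ⟨q, hq, rfl⟩
      refine ⟨?_, q, hondaAxis_subset_hondaTube hr₃pos hq, rfl⟩
      rw [mem_zeroLocus, h2γ q hq]
      exact (hsf.isStrictlyNearPositive.isPositiveZero_of_mem
        (h.isZeroCircle.mem_zeroLocus _)).mem_zeroLocus
  -- the jet at the axis
  have hsm : IsSmoothForm sf := hsf.isSmoothForm
  have hZ : ∀ θ, sf (γ θ) = 0 := fun θ ↦
    (hsf.isStrictlyNearPositive.isPositiveZero_of_mem (h.isZeroCircle.mem_zeroLocus θ)).mem_zeroLocus
  have h2jet : ∀ θ W U V, zeroGradient (sf.pullback 𝓘(ℝ, EuclideanSpace ℝ (Fin 4)) χ₂)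
      (hondaAxisPoint θ) W ![U, V] = σ * ∑ k, (Mb θ *ᵥ normalPart W) k * hondaBetaVec U V k := by
    intro θ W U V
    set a := hondaAxisPoint θ with ha
    set G : MForm (𝓡 4) (EuclideanSpace ℝ (Fin 4)) ℝ 2 :=
      sf.pullback 𝓘(ℝ, EuclideanSpace ℝ (Fin 4)) χ with hG
    -- `χ₂^* sf = Φ^* G` near `a`
    have hloc : ∀ᶠ y in 𝓝 a, (sf.pullback 𝓘(ℝ, EuclideanSpace ℝ (Fin 4)) χ₂ y :
        (EuclideanSpace ℝ (Fin 4)) [⋀^Fin 2]→L[ℝ] ℝ) =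
        G.pullback 𝓘(ℝ, EuclideanSpace ℝ (Fin 4)) Φ y := by
      filter_upwards [(isOpen_hondaTube r₂).mem_nhds (hondaAxisPoint_mem_hondaTube hr₂ θ)]
        with y hy
      have hc : mfderiv 𝓘(ℝ, EuclideanSpace ℝ (Fin 4)) (𝓡 4) χ₂ y =
          (mfderiv 𝓘(ℝ, EuclideanSpace ℝ (Fin 4)) (𝓡 4) χ (Φ y)).comp
            (mfderiv 𝓘(ℝ, EuclideanSpace ℝ (Fin 4)) 𝓘(ℝ, EuclideanSpace ℝ (Fin 4)) Φ y) :=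
        mfderiv_comp y (hχmd _ (hmaps hy)) (hΦmd y)
      ext v
      rw [MForm.pullback_apply, hc, hG, MForm.pullback_apply, MForm.pullback_apply]
      rfl
    have hfd : zeroGradient (sf.pullback 𝓘(ℝ, EuclideanSpace ℝ (Fin 4)) χ₂) a =
        zeroGradient (G.pullback 𝓘(ℝ, EuclideanSpace ℝ (Fin 4)) Φ) a := by
      rw [zeroGradient_eq_fderiv_model, zeroGradient_eq_fderiv_model]
      exact Filter.EventuallyEq.fderiv_eq (hloc.mono fun y hy ↦ hy)
    -- hypotheses of the transport lemma for `Φ`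
    have hΦev : ∀ᶠ z in 𝓝 a, ContMDiffAt 𝓘(ℝ, EuclideanSpace ℝ (Fin 4)) (𝓡 4) ∞ Φ z :=
      Filter.Eventually.of_forall fun z ↦ hΦs.contMDiff.contMDiffAt
    have hGa : G a = 0 := by
      simp only [hG]; exact pullback_hondaAxisPoint_eq_zero hχγ hZ θ
    have hGs : G.SmoothAt (Φ a) := by
      rw [hΦax]
      have hcd : ContDiffAt ℝ (F := (EuclideanSpace ℝ (Fin 4)) [⋀^Fin 2]→L[ℝ] ℝ) ∞
          (fun y ↦ G y) a :=
        (contDiffOn_pullback_hondaTube hχs hsm).contDiffAt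
          ((isOpen_hondaTube r).mem_nhds (hondaAxisPoint_mem_hondaTube hr θ))
      unfold MForm.SmoothAt
      rw [inChart_eq_self_model]
      have hx : extChartAt 𝓘(ℝ, EuclideanSpace ℝ (Fin 4)) a a = a := by simp
      rw [show extChartAt (𝓡 4) a a = a from hx]
      exact hcd.contDiffWithinAt
    have hG0 : G (Φ a) = 0 := by rw [hΦax]; exact hGa
    have hflat : flatDifferential Φ a =
        ((A θ : EuclideanSpace ℝ (Fin 4) ≃L[ℝ] EuclideanSpace ℝ (Fin 4)) :
          EuclideanSpace ℝ (Fin 4) →L[ℝ] EuclideanSpace ℝ (Fin 4)) := by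
      rw [flatDifferential_eq, mfderiv_eq_fderiv]
      exact fderiv_blockReparam_hondaAxisPoint hAs hA0 θ
    rw [hfd, zeroGradient_pullback_eq_comp hΦev hGs hG0 W,
      ContinuousAlternatingMap.compContinuousLinearMap_apply, hflat]
    have hvec : ((((A θ : EuclideanSpace ℝ (Fin 4) ≃L[ℝ] EuclideanSpace ℝ (Fin 4)) :
        EuclideanSpace ℝ (Fin 4) →L[ℝ] EuclideanSpace ℝ (Fin 4)) : _ → _) ∘ ![U, V]) =
        ![A θ U, A θ V] := by
      funext i; fin_cases i <;> rfl
    rw [hvec, hΦax]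
    exact hgrad θ W U V
  exact ⟨r₃, χ₂, σ, Mb, hr₃pos, h2per, h2s.mono h32, h2inj, fun q hq ↦ h2imm q (h32 hq),
    (image_mono fun q hq ↦ hmaps (h32 hq)).trans (by
      rintro _ ⟨q, hq, rfl⟩; exact hχN ⟨Φ q, hq, rfl⟩),
    h2γ, h2ax, h2zero, hMs, hσ, hMsym, hblock, hneg, hposb, hMP, h2jet⟩

end Literature.Geometry.Symplectic

end
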